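import Mathlib
import Summits.KontsevichZagierPeriods.Zeta5Search.BrickTopCoefficient

/-!
# BrickTopOffDigit — the OFF-DIGIT VALUATION LEMMA (E) for the leading coefficient of the brick kernel:
`v_p(c_{jp+i,A}(np)) = A·(1 + v_p((n−j)C(n,j))) + B·(v_p(C(n+j,j)) + v_p(C(2n−1−j,n)))` (cell zeta5-irr)

HONEST FRAMING: systematic search; no irrationality claim unless certified. INSTRUMENT lemma of the ζ(5)
census cell zeta5-irr (HOME `run/shared/lean/pub/zeta5-irr/`; memo `zi-p2/LEMMAS.md` §B8-a′ «OFF-DIGIT VALUATION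
LEMMA (PROVED, THEOREM3.md §5): for the kernel (A,B,1), p ≥ 5, 2n ≤ p², K = jp+i off-digit: (E) v_p(c_{K,A}(np)) =
A + A v_p(n) + B v_p(C(n+j,j)C(2n−1−j,n)) + A v_p(C(n−1,j)) exactly», the `s = A` input of THEOREM 5 Step G /
THEOREM 4's COROLLARY). Nothing here is about ζ(5); no irrationality content; filing moves no rung. Filed by the
engine seat zi-eng (g7); inputs: `BrickTopCoefficient.cTop` (the leading coefficient in closed form) and zi-eng g6's
exact off-digit binomial valuations `OffDigitBinomials.padicValNat_choose_offDigit` /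
`padicValNat_choose_shift_offDigit`.

## The statement

For an odd prime `p`, every `A B ε`, `j < n` and `1 ≤ i ≤ p−1` (`K = jp + i` an OFF-DIGIT index of `R_{np}`):
the closed-form leading coefficient `cTop A B ε (np) K = (−1)^{…}(np/2 − K)^ε·C(np,K)^A·[C(np+K,K)·C(2np−K,np)]^B`
has `p`-adic valuation
**`v_p = A·(1 + v_p((n−j)·C(n,j))) + B·(v_p(C(n+j,j)) + v_p(C(2n−1−j,n)))`** (`padicValRat_cTop_offDigit`):
`v_p(C(np, jp+i)) = 1 + v_p((n−j)C(n,j))` and `v_p(C((n+j)p+i, jp+i)) = v_p(C(n+j,j))` are g6's lemmas; the third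
binomial is a shifted off-digit binomial in disguise, `C(2np−K, np) = C((n+(n−j−1))p + (p−i), (n−j−1)p + (p−i))`
(`choose_two_mul_sub_offDigit`), of valuation `v_p(C(2n−1−j, n−j−1)) = v_p(C(2n−1−j, n))`; the centre factor
`np/2 − K = ((n−2j)p − 2i)/2` is a `p`-unit (`p ∤ 2i`). (Here `2n ≤ p²` is not needed: the formula is exact for all
`n`; zi-p2's `(n−j)C(n,j) = n·C(n−1,j)` form is the same number.)
-/

namespace Summit.KontsevichZagierPeriods.Zeta5Search.BrickTopOffDigit

open Finset Nat
open Summit.KontsevichZagierPeriods.Zeta5Search.BrickTopCoefficient (cTop)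
open Summit.KontsevichZagierPeriods.Zeta5Search.OffDigitBinomials (padicValNat_choose_offDigit
  padicValNat_choose_shift_offDigit)

variable {p : ℕ}

/-- **The second numerator binomial at an off-digit index is a shifted off-digit binomial**: for `j < n`,
`i < p`: `C(2np − (jp+i), np) = C((n + (n−j−1))p + (p−i), (n−j−1)p + (p−i))`. -/
theorem choose_two_mul_sub_offDigit {n j i : ℕ} (hjn : j < n) (hip : i < p) :
    (2 * (n * p) - (j * p + i)).choose (n * p) = ((n + (n - j - 1)) * p + (p - i)).choose ((n - j - 1) * p + (p - i)) := by
  obtain ⟨d, rfl⟩ : ∃ d, n = j + 1 + d := ⟨n - j - 1, by omega⟩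
  obtain ⟨e, rfl⟩ : ∃ e, p = i + e := ⟨p - i, by omega⟩
  have h1 : j + 1 + d - j - 1 = d := by omega
  have h2 : i + e - i = e := by omega
  rw [h1, h2]
  have h3 : 2 * ((j + 1 + d) * (i + e)) - (j * (i + e) + i) = (j + 1 + d + d) * (i + e) + e := by
    have : 2 * ((j + 1 + d) * (i + e)) = (j * (i + e) + i) + ((j + 1 + d + d) * (i + e) + e) := by ring
    omega
  have h4 : (j + 1 + d + d) * (i + e) + e - (j + 1 + d) * (i + e) = d * (i + e) + e := by
    have : (j + 1 + d + d) * (i + e) + e = (j + 1 + d) * (i + e) + (d * (i + e) + e) := by ring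
    omega
  rw [h3, ← Nat.choose_symm (by nlinarith : (j + 1 + d) * (i + e) ≤ (j + 1 + d + d) * (i + e) + e), h4]

/-- … and its valuation is `v_p(C(2n−1−j, n))` (odd prime `p`, `j < n`, `1 ≤ i < p`). -/
theorem padicValNat_choose_two_mul_sub_offDigit (hp : p.Prime) {n j i : ℕ} (hjn : j < n) (hi1 : 1 ≤ i) (hip : i < p) :
    padicValNat p ((2 * (n * p) - (j * p + i)).choose (n * p)) = padicValNat p ((2 * n - 1 - j).choose n) := by
  rw [choose_two_mul_sub_offDigit hjn hip, padicValNat_choose_shift_offDigit hp n (n - j - 1) (by omega),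
    show n + (n - j - 1) = 2 * n - 1 - j by omega, ← Nat.choose_symm (by omega : n - j - 1 ≤ 2 * n - 1 - j),
    show 2 * n - 1 - j - (n - j - 1) = n by omega]

/-- The centre factor at an off-digit index is a `p`-unit: `p ∤ np − 2(jp+i)` for an odd prime `p`, `1 ≤ i < p`. -/
theorem not_dvd_centre (hp : p.Prime) (hp2 : p ≠ 2) (n j : ℕ) {i : ℕ} (hi1 : 1 ≤ i) (hip : i < p) :
    ¬ (p : ℤ) ∣ (n * p : ℤ) - 2 * (j * p + i) := by
  intro h
  have h2 : (p : ℤ) ∣ 2 * (i : ℤ) := by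
    have h' : (p : ℤ) ∣ ((n : ℤ) - 2 * j) * p := Dvd.intro_left _ rfl
    have := dvd_sub h' h
    rw [show ((n : ℤ) - 2 * j) * p - ((n * p : ℤ) - 2 * (j * p + i)) = 2 * (i : ℤ) by ring] at this
    exact this
  have h3 : p ∣ 2 * i := by exact_mod_cast h2
  rcases (Nat.Prime.dvd_mul hp).1 h3 with h4 | h4
  · exact hp2 ((Nat.prime_dvd_prime_iff_eq hp Nat.prime_two).1 h4)
  · exact absurd (Nat.le_of_dvd (by omega) h4) (by omega)

/-- **OFF-DIGIT VALUATION LEMMA (E)** (zi-p2 THEOREM3.md §5; THEOREM 5 Step G at `s = A`): for an odd prime `p`,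
every `A B ε`, `j < n`, `1 ≤ i < p`:
`v_p(cTop A B ε (np) (jp+i)) = A·(1 + v_p((n−j)·C(n,j))) + B·(v_p(C(n+j,j)) + v_p(C(2n−1−j,n)))`. -/
theorem padicValRat_cTop_offDigit [Fact p.Prime] (hp2 : p ≠ 2) (A B ε : ℕ) {n j i : ℕ} (hjn : j < n) (hi1 : 1 ≤ i)
    (hip : i < p) :
    padicValRat p (cTop A B ε (n * p) (j * p + i)) =
      A * (1 + padicValNat p ((n - j) * n.choose j)) +
        B * (padicValNat p ((n + j).choose j) + padicValNat p ((2 * n - 1 - j).choose n)) := by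
  have hp : p.Prime := Fact.out
  -- the pieces and their non-vanishing
  have hK : j * p + i ≤ n * p := by nlinarith
  have hc1 : ((n * p).choose (j * p + i) : ℚ) ≠ 0 := by exact_mod_cast (Nat.choose_pos hK).ne'
  have hc2 : ((n * p + (j * p + i)).choose (j * p + i) : ℚ) ≠ 0 := by
    exact_mod_cast (Nat.choose_pos (Nat.le_add_left _ _)).ne'
  have hc3 : ((2 * (n * p) - (j * p + i)).choose (n * p) : ℚ) ≠ 0 := by
    exact_mod_cast (Nat.choose_pos (by omega : n * p ≤ 2 * (n * p) - (j * p + i))).ne'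
  have hz : ¬ (p : ℤ) ∣ (n * p : ℤ) - 2 * (j * p + i) := not_dvd_centre hp hp2 n j hi1 hip
  have hz0 : ((n * p : ℤ) - 2 * (j * p + i) : ℤ) ≠ 0 := fun h => hz (by rw [h]; exact dvd_zero _)
  have hcentre : ((n * p : ℕ) : ℚ) / 2 - ((j * p + i : ℕ) : ℚ) = (((n * p : ℤ) - 2 * (j * p + i) : ℤ) : ℚ) / 2 := by
    push_cast; ring
  have hcen0 : ((n * p : ℕ) : ℚ) / 2 - ((j * p + i : ℕ) : ℚ) ≠ 0 := by
    rw [hcentre]; exact div_ne_zero (by exact_mod_cast hz0) two_ne_zero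
  have hvcen : padicValRat p (((n * p : ℕ) : ℚ) / 2 - ((j * p + i : ℕ) : ℚ)) = 0 := by
    rw [hcentre, padicValRat.div (by exact_mod_cast hz0) two_ne_zero, padicValRat.of_int,
      padicValInt.eq_zero_of_not_dvd hz, show (2 : ℚ) = ((2 : ℕ) : ℚ) by norm_num, padicValRat.of_nat,
      padicValNat.eq_zero_of_not_dvd (fun h => hp2 ((Nat.prime_dvd_prime_iff_eq hp Nat.prime_two).1 h))]
    simp
  have hvsign : padicValRat p ((-1 : ℚ) ^ (n * p * B + (j * p + i) * A)) = 0 := by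
    rw [padicValRat.pow, padicValRat.neg, padicValRat.one, mul_zero]
  have hs0 : ((-1 : ℚ) ^ (n * p * B + (j * p + i) * A)) ≠ 0 := pow_ne_zero _ (by norm_num)
  -- assemble
  unfold cTop
  rw [padicValRat.mul (mul_ne_zero (mul_ne_zero hs0 (pow_ne_zero _ hcen0)) (pow_ne_zero _ hc1))
      (pow_ne_zero _ (mul_ne_zero hc2 hc3)),
    padicValRat.mul (mul_ne_zero hs0 (pow_ne_zero _ hcen0)) (pow_ne_zero _ hc1),
    padicValRat.mul hs0 (pow_ne_zero _ hcen0), hvsign, padicValRat.pow, hvcen, padicValRat.pow,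
    padicValRat.pow, padicValRat.mul hc2 hc3, padicValRat.of_nat, padicValRat.of_nat, padicValRat.of_nat,
    padicValNat_choose_offDigit hp hjn hi1 hip, show n * p + (j * p + i) = (n + j) * p + i by ring,
    padicValNat_choose_shift_offDigit hp n j hip, padicValNat_choose_two_mul_sub_offDigit hp hjn hi1 hip]
  push_cast
  ring

end Summit.KontsevichZagierPeriods.Zeta5Search.BrickTopOffDigit
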